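import Summits.ResolutionOfSingularities.ResolutionOfSingularities.Theorems.FrobeniusClosingSteerArithLeafWords
import Summits.ResolutionOfSingularities.ResolutionOfSingularities.Theorems.FrobeniusClosingSteerCleanedOrderExists
import Summits.ResolutionOfSingularities.ResolutionOfSingularities.Theorems.FrobeniusClosingSteerVisitSequenceEventuallyConstant
import HarnessLib

/-!
# Crux `Steer` (stmt-ResolutionOfSingularities-16345), chain W4.1 — hS1b ASSEMBLY (FILE B): `ArithLeaf.EventuallyConstantReducedOrderTwoN`
# from the two A2 visit laws (W-VM `ReducedOrderVisitLaw`, W-ESC `EscapeLaw`, taken as BINDERS in their typed bodies until A2 lands),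
# the cleaned-order existence (M1) and the eventual-constancy lemma (M3); the parity step (M4) consumes the non-persistence binder `hnp`

OURS (campaign `res-hironaka`, rung L ★L-G4, slot W4.1; seat res-D-lib-2 g10 = FILE B of res-L0-w41-strat-2 g4's hS1b PROOF MAP v1.0 (19:50:12Z;
words `L/res-L0-w41-strat-2/S1B/ReducedOrderWords_sketch.lean` fb31e0fd4d0a20c0, tri-1 VERDICT-S1b PASS 20:01:37Z) on res-L0-w41-plan-1 RULINGS 264(d)/272(d)).
Candidates, not facts; nothing here is a statement of H. Hironaka's manuscript [Hironaka2017] (status: under review). AI-written; AI review is weaker than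
expert review.

THE ASSEMBLY (`eventuallyConstantReducedOrderTwoN_of_visitLaws hVM hESC : ArithLeaf.EventuallyConstantReducedOrderTwoN`; `hVM` / `hESC` = the bodies of
strat-2's W-VM / W-ESC universally closed over the field — A2 `…ReducedOrderVisitLaw` discharges them, then `eventuallyConstantReducedOrderTwoN_holds` is one
line). (M0) intro the word; members local/regular/dominated, residue fields perfect (`MembersPerfectResidue`), exceptional parameters `x_j` chosen from the
strict-step clause. (M1) `CleanedOrderExists.exists_hasCleanedOrderAt_of_run`: an exact cleaned order `ν_i` at EVERY stage; the reduced order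
`d_i := ν_i − [∃ odd divisor at i]` (`Classical`), `HasReducedOrderAt … i d_i` at late stages (`ν_i ≥ 3` by `hhigh`), and both orders are UNIQUE. (M2) = `hVM` at
each late visit pair with `x_j`, `hΓ`, `h0/h1` at `j′` ⇒ `d_{j′} ≤ d_j`. (M3) `VisitSequence.eventually_const_of_visitPairs` ⇒ `d_i = c` at all point steps
`i ≥ i₁`. (M4) PARITY: if `c` were even, an odd-cleaned visit `i ≥ i₁` (`hodd`) has `ν_i = c + 1`; along every later visit pair the old exceptional parameter
is an ODD DIVISOR at the new visit (`VisitLawDelta.visitLaw₂_of_run`: clord `1`; `VisitLawPointStep.prime_excParam_succ`: regular parameter), so `ν = c + 1`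
propagates to all later visits; `hESC` on consecutive visit triples makes all later exceptional parameters EQUIVALUED with `x_i`; then `x_i` is an exceptional
parameter of EVERY later point step and every `y` of value `< 1` in a later member becomes divisible by `x_i` after the next point step
(`VisitLawPointStep.span_image_maximalIdeal_eq`) — the persistence `hnp` forbids. Hence `c` is ODD, `c ≥ 3`, every late point step has reduced order `c`, and
the odd-cleaned visits (`hodd`) are A-stages of order `c`. USED binders: core hR0 hrun hhigh hnp hodd hreg hdim h0 h1 hΓ; UNUSED: hrk hN hnd h2inf hinf hwild.
-/

-- `Summit.<S>.<S>.…` duplicates the summit name by design (single-problem summit).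
set_option linter.dupNamespace false

open IsLocalRing
open Literature.AlgebraicGeometry.Resolution
open Summit.ResolutionOfSingularities.ResolutionOfSingularities.Theorems.SwitchingDichotomy.Words
open Summit.ResolutionOfSingularities.ResolutionOfSingularities.Theorems.SwitchingDichotomy

namespace Summit.ResolutionOfSingularities.ResolutionOfSingularities.Theorems.SwitchingDichotomy.ReducedOrderAssembly

variable {K : Type} [Field K]

/-! ## §1 Bookkeeping: uniqueness of the cleaned order, `ν ≥ 3` in the high-order regime, propagation along visit pairs -/

/-- The exact cleaned order is unique. [folklore] -/
theorem cleanedOrder_unique {R : ℕ → Subring K} {s : ℕ → K} {i a b : ℕ} (ha : HasCleanedOrderAt R s 2 i a)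
    (hb : HasCleanedOrderAt R s 2 i b) : a = b := by
  obtain ⟨_, hs, ⟨g, hg⟩, hex⟩ := ha
  obtain ⟨_, hs', ⟨g', hg'⟩, hex'⟩ := hb
  by_contra hne
  rcases Nat.lt_or_gt_of_ne hne with h | h
  · exact hex g' (Ideal.pow_le_pow_right (by omega) hg')
  · exact hex' g (Ideal.pow_le_pow_right (by omega) hg)

/-- In the high-order regime (`f − g² ∈ 𝔪³` for some `g`) the exact cleaned order is at least `3`. [folklore] -/
theorem three_le_of_isHighOrderAt {R : ℕ → Subring K} {s : ℕ → K} {j ν : ℕ}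
    (hhigh : IsHighOrderAt R s 2 j) (hclean : HasCleanedOrderAt R s 2 j ν) : 3 ≤ ν := by
  obtain ⟨_, hs, g, hg⟩ := hhigh
  obtain ⟨_, hs', -, hex⟩ := hclean
  by_contra hlt
  exact hex g (Ideal.pow_le_pow_right (by omega) hg)

/-- A property which holds at a point step `i` and propagates along late visit pairs holds at every later point step. [folklore] -/
theorem all_pointSteps_of_visitPairs (R : ℕ → Subring K) (P : (i : ℕ) → Ideal (R i))
    (hrec : ∀ i₀ : ℕ, ∃ i, i₀ ≤ i ∧ IsPointStep R P i) (Q : ℕ → Prop) {i₀ : ℕ}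
    (hstep : ∀ j j', i₀ ≤ j → IsVisitPair R P j j' → Q j → Q j') {i : ℕ} (hi : i₀ ≤ i) (hpt : IsPointStep R P i) (hQ : Q i) :
    ∀ J, i ≤ J → IsPointStep R P J → Q J := by
  suffices h : ∀ n, ∀ j J, J - j ≤ n → i₀ ≤ j → j ≤ J → IsPointStep R P j → Q j → IsPointStep R P J → Q J from
    fun J hJ hptJ => h (J - i) i J le_rfl hi hJ hpt hQ hptJ
  intro n
  induction n with
  | zero =>
    intro j J hn _ hle _ hq _
    have : J = j := by omega
    rw [this]; exact hq
  | succ n ih =>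
    intro j J hn h0 hle hj hq hJ
    rcases Nat.eq_or_lt_of_le hle with rfl | hlt
    · exact hq
    obtain ⟨j₁, hvisit⟩ := VisitSequence.exists_isVisitPair_of_pointStep R P hrec hj
    have hj₁J : j₁ ≤ J := by
      by_contra hlt'
      exact hvisit.2.2.2 J hlt (not_le.mp hlt') hJ
    exact ih j₁ J (by have := hvisit.1; omega) (by have := hvisit.1; omega) hj₁J hvisit.2.2.1 (hstep j j₁ h0 hvisit hq) hJ

/-! ## §2 The assembly -/

/-- **hS1b from the two visit laws.** `hVM` and `hESC` are the bodies of strat-2's W-VM `ReducedOrderVisitLaw` and W-ESC `EscapeLaw`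
(`S1B/ReducedOrderWords_sketch.lean` fb31e0fd4d0a20c0), closed over the field; A2 `…ReducedOrderVisitLaw` discharges them. OURS. [folklore] -/
theorem eventuallyConstantReducedOrderTwoN_of_visitLaws
    (hVM : ∀ (K : Type) [Field K] [CharP K 2] (O : ValuationSubring K) (R : ℕ → Subring K) (P : (i : ℕ) → Ideal (R i))
      (t : K) (s : ℕ → K),
      IsSteeredRun O R P t 2 s → SubringDominates (R 0) O.toSubring →
      (∀ i, IsRegularLocalRing (R i)) → (∀ i, ringKrullDim (R i) = (4 : ℕ)) →
      (∀ i, ∃ _ : IsLocalRing (R i), PerfectField (ResidueField (R i))) →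
      ∀ (j j' : ℕ) (x : K), IsVisitPair R P j j' →
        ((∃ h : x ∈ R j, (⟨x, h⟩ : R j) ∈ P j) ∧ x ≠ 0 ∧ ∀ y : R j, y ∈ P j → O.valuation (y : K) ≤ O.valuation x) →
        (∀ k, j < k → k < j' → ∃ hx : x ∈ R k, P k = Ideal.span {(⟨x, hx⟩ : R k)}) →
        (∀ (hs' : s j' ^ 2 ∈ R j') (Q : Ideal (R j')) [Q.IsPrime], Q.height = 0 →
          ¬ SigmaTopLegality.IsSingPrime (R j') 2 ⟨s j' ^ 2, hs'⟩ Q) →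
        (∀ (hs' : s j' ^ 2 ∈ R j') (Q : Ideal (R j')) [Q.IsPrime], Q.height = 1 →
          ¬ SigmaTopLegality.IsSingPrime (R j') 2 ⟨s j' ^ 2, hs'⟩ Q) →
        ∀ (ν d : ℕ), 2 ≤ ν → HasCleanedOrderAt R s 2 j ν → HasReducedOrderAt R s 2 j d →
          ∃ ν' d' : ℕ, HasCleanedOrderAt R s 2 j' ν' ∧ HasReducedOrderAt R s 2 j' d' ∧ ν' ≤ ν + 1 ∧ d' ≤ d)
    (hESC : ∀ (K : Type) [Field K] [CharP K 2] (O : ValuationSubring K) (R : ℕ → Subring K) (P : (i : ℕ) → Ideal (R i))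
      (t : K) (s : ℕ → K),
      IsSteeredRun O R P t 2 s → SubringDominates (R 0) O.toSubring →
      (∀ i, IsRegularLocalRing (R i)) → (∀ i, ringKrullDim (R i) = (4 : ℕ)) →
      (∀ i, ∃ _ : IsLocalRing (R i), PerfectField (ResidueField (R i))) →
      ∀ (j j' j'' : ℕ) (x x' : K), IsVisitPair R P j j' → IsVisitPair R P j' j'' →
        ((∃ h : x ∈ R j, (⟨x, h⟩ : R j) ∈ P j) ∧ x ≠ 0 ∧ ∀ y : R j, y ∈ P j → O.valuation (y : K) ≤ O.valuation x) →
        ((∃ h : x' ∈ R j', (⟨x', h⟩ : R j') ∈ P j') ∧ x' ≠ 0 ∧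
          ∀ y : R j', y ∈ P j' → O.valuation (y : K) ≤ O.valuation x') →
        (∀ k, j < k → k < j' → ∃ hx : x ∈ R k, P k = Ideal.span {(⟨x, hx⟩ : R k)}) →
        (∀ k, j' < k → k < j'' → ∃ hx : x' ∈ R k, P k = Ideal.span {(⟨x', hx⟩ : R k)}) →
        (∀ i ∈ ({j', j''} : Set ℕ), ∀ (hs' : s i ^ 2 ∈ R i) (Q : Ideal (R i)) [Q.IsPrime], Q.height = 0 →
          ¬ SigmaTopLegality.IsSingPrime (R i) 2 ⟨s i ^ 2, hs'⟩ Q) →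
        (∀ i ∈ ({j', j''} : Set ℕ), ∀ (hs' : s i ^ 2 ∈ R i) (Q : Ideal (R i)) [Q.IsPrime], Q.height = 1 →
          ¬ SigmaTopLegality.IsSingPrime (R i) 2 ⟨s i ^ 2, hs'⟩ Q) →
        ∀ (ν ν' : ℕ), Odd ν → Odd ν' → 2 ≤ ν → 2 ≤ ν' → HasCleanedOrderAt R s 2 j ν → HasCleanedOrderAt R s 2 j' ν' →
          O.valuation x = O.valuation x') :
    ArithLeaf.EventuallyConstantReducedOrderTwoN := by
  intro p hp2 k K _ _ _ _ _ O A₀ h₀ t core hrk R P s hR0 hN hrun hnd hhigh h2inf hinf hwild hnp hodd hreg hdim N₁ h0 h1 hΓ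
  subst hp2
  classical
  haveI : CharP K 2 := charP_of_injective_algebraMap (algebraMap k K).injective 2
  -- ### (M0) the run's clauses and the members
  haveI hRloc : ∀ i, IsLocalRing (R i) := fun i => (hrun.2 i).1
  have hsp : ∀ i, s i ^ 2 ∈ R i := fun i => (hrun.2 i).2.1
  have hbl : ∀ i, IsLocalBlowupAlong O (R i) (P i) (R (i + 1)) := fun i => (hrun.2 i).2.2.2.1
  have hst : ∀ i, ∃ x g : K, ((∃ hx : x ∈ R i, (⟨x, hx⟩ : R i) ∈ P i) ∧ x ≠ 0 ∧
      ∀ y : R i, y ∈ P i → O.valuation (y : K) ≤ O.valuation x) ∧ g ∈ R i ∧ s i = x * s (i + 1) + g :=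
    fun i => (hrun.2 i).2.2.2.2
  choose xx gg hxg using hst
  have hxx : ∀ i, (∃ hx : xx i ∈ R i, (⟨xx i, hx⟩ : R i) ∈ P i) ∧ xx i ≠ 0 ∧
      ∀ y : R i, y ∈ P i → O.valuation (y : K) ≤ O.valuation (xx i) := fun i => (hxg i).1
  obtain ⟨hfg, htp, hfr, hregc, -, h0c, hdimc, -, -, -, -, hc, htr, -⟩ := id core
  have hdom0 : SubringDominates (R 0) O.toSubring := by
    rw [hR0]
    exact subringDominates_locAtCentre h₀
  have hdom : ∀ i, SubringDominates (R i) O.toSubring := fun i => VisitLawPointStep.subringDominates_of_run hrun hdom0 i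
  have hval : ∀ i (a : R i), a ∈ maximalIdeal (R i) ↔ O.valuation (a : K) < 1 := fun i =>
    (subringDominates_valuationSubring_iff (hdom i).1).mp (hdom i)
  have hperf : ∀ i, ∃ _ : IsLocalRing (R i), PerfectField (ResidueField (R i)) := fun i =>
    ⟨hRloc i, MembersPerfectResidue.perfectField_residueField_of_steps O A₀ h₀ h0c R P i hR0 (fun j _ => hbl j)⟩
  have hmono : ∀ i j, i ≤ j → R i ≤ R j := by
    intro i j hij
    induction hij with
    | refl => exact le_rfl
    | step _ ih => exact ih.trans (hbl _).isLocalBlowup.le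
  -- point steps recur
  have hrec : ∀ i₀ : ℕ, ∃ i, i₀ ≤ i ∧ IsPointStep R P i := fun i₀ => by
    obtain ⟨i, hi, hO⟩ := hodd i₀
    exact ⟨i, hi, hO.1⟩
  -- ### (M1) exact cleaned orders everywhere; the reduced order
  have hνex : ∀ i, ∃ ν, HasCleanedOrderAt R s 2 i ν :=
    CleanedOrderExists.exists_hasCleanedOrderAt_of_run O A₀ h₀ t core R P s hR0 hrun
  choose ν hν using hνex
  obtain ⟨iH, hiH⟩ := hhigh
  have hν3 : ∀ i, iH ≤ i → 3 ≤ ν i := fun i hi => three_le_of_isHighOrderAt (hiH i hi) (hν i)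
  let dd : ℕ → ℕ := fun i => if (∃ y : K, IsOddDivisorAt R s 2 i y) then ν i - 1 else ν i
  have hdd_odd : ∀ i, (∃ y : K, IsOddDivisorAt R s 2 i y) → dd i = ν i - 1 := fun i h => by
    simp only [dd, if_pos h]
  have hdd_no : ∀ i, (¬ ∃ y : K, IsOddDivisorAt R s 2 i y) → dd i = ν i := fun i h => by
    simp only [dd, if_neg h]
  have hred : ∀ i, iH ≤ i → HasReducedOrderAt R s 2 i (dd i) := by
    intro i hi
    by_cases hex : ∃ y : K, IsOddDivisorAt R s 2 i y
    · refine ⟨ν i, hν i, Or.inr ⟨hex, ?_⟩⟩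
      rw [hdd_odd i hex]; have := hν3 i hi; omega
    · refine ⟨ν i, hν i, Or.inl ⟨fun y hy => hex ⟨y, hy⟩, hdd_no i hex⟩⟩
  have hruniq : ∀ i d', HasReducedOrderAt R s 2 i d' → d' = dd i := by
    intro i d' hd'
    obtain ⟨ν', hν', hcase⟩ := hd'
    have hνν : ν' = ν i := cleanedOrder_unique hν' (hν i)
    rcases hcase with ⟨hno, hd⟩ | ⟨hex, hd⟩
    · rw [hdd_no i (fun ⟨y, hy⟩ => hno y hy), hd, hνν]
    · rw [hdd_odd i hex]; omega
  -- ### (M2) the reduced order does not increase across late visit pairs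
  set N : ℕ := max N₁ iH with hNdef
  have hstep : ∀ j j', N ≤ j → IsVisitPair R P j j' → dd j' ≤ dd j := by
    intro j j' hj hv
    have hN₁j : N₁ ≤ j := le_trans (le_max_left _ _) hj
    have hiHj : iH ≤ j := le_trans (le_max_right _ _) hj
    have hj' : N₁ ≤ j' := le_trans hN₁j (le_of_lt hv.1)
    obtain ⟨ν', d', -, hd', -, hle⟩ := hVM K O R P t s hrun hdom0 hreg hdim hperf j j' (xx j) hv (hxx j)
      (hΓ j j' (xx j) hN₁j hv (hxx j)) (h0 j' hj' hv.2.2.1) (h1 j' hj' hv.2.2.1) (ν j) (dd j)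
      (by have := hν3 j hiHj; omega) (hν j) (hred j hiHj)
    rw [hruniq j' d' hd'] at hle
    exact hle
  -- ### (M3) eventual constancy
  obtain ⟨i₁, c, hNi₁, hpt₁, hc₁, hconst⟩ := VisitSequence.eventually_const_of_visitPairs R P hrec dd hstep
  have hN₁i₁ : N₁ ≤ i₁ := le_trans (le_max_left _ _) hNi₁
  have hiHi₁ : iH ≤ i₁ := le_trans (le_max_right _ _) hNi₁
  -- ### (M4) parity: `c` is odd
  have hcodd : Odd c := by
    by_contra hce
    have hc2 : c % 2 = 0 := Nat.even_iff.mp (Nat.not_odd_iff_even.mp hce)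
    -- an odd-cleaned visit `i ≥ i₁`: `ν i = c + 1`
    obtain ⟨i, hi, hOi⟩ := hodd i₁
    obtain ⟨hpti, _, hsi, d₀, hd₀odd, hd₀ex, hd₀exact⟩ := hOi
    have hνi : ν i = d₀ := cleanedOrder_unique (hν i) ⟨hRloc i, hsi, hd₀ex, hd₀exact⟩
    have hiH_i : iH ≤ i := le_trans hiHi₁ hi
    have hνic : ν i = c + 1 := by
      have hdi : dd i = c := hconst i hi hpti
      by_cases hex : ∃ y : K, IsOddDivisorAt R s 2 i y
      · rw [hdd_odd i hex] at hdi; have := hν3 i hiH_i; omega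
      · rw [hdd_no i hex] at hdi
        exfalso
        have hoc : Odd c := by rw [← hdi, hνi]; exact hd₀odd
        exact hce hoc
    -- `ν = c + 1` propagates to all later point steps: the old exceptional parameter is an odd divisor at the next visit
    have hQ : ∀ J, i ≤ J → IsPointStep R P J → ν J = c + 1 := by
      refine all_pointSteps_of_visitPairs R P hrec (fun J => ν J = c + 1) (i₀ := i) ?_ le_rfl hpti hνic
      intro j j' hij hv hνj
      have hN₁j : N₁ ≤ j := le_trans hN₁i₁ (le_trans hi hij)
      have hiHj : iH ≤ j := le_trans hiHi₁ (le_trans hi hij)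
      have hj' : N₁ ≤ j' := le_trans hN₁j (le_of_lt hv.1)
      have hcl : HasCleanedOrderAt R s 2 j (c + 1) := hνj ▸ hν j
      obtain ⟨⟨hRj', -⟩, -, hclord⟩ := VisitLawDelta.visitLaw₂_of_run hrun hdom0 hv (hxx j)
        (hΓ j j' (xx j) hN₁j hv (hxx j)) hreg (h1 j' hj' hv.2.2.1) (by have := hν3 i hiH_i; omega) hcl
      have hx1 : xx j ∈ R (j + 1) := (hbl j).isLocalBlowup.le (hxx j).1.fst
      obtain ⟨hxm, hx2, -⟩ := VisitLawPointStep.prime_excParam_succ hrun hdom0 hv.2.1 (hreg j) (hreg (j + 1)) (hxx j) hx1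
      have hmod : (c + 1) % 2 = 1 := by omega
      rw [hmod] at hclord
      have hoddx : IsOddDivisorAt R s 2 j' (xx j) := by
        have key : ∀ (S : Subring K) (hS : S = R (j + 1)) (hxS : xx j ∈ S) [IsLocalRing S],
            (⟨xx j, hxS⟩ : S) ∈ maximalIdeal S ∧ (⟨xx j, hxS⟩ : S) ∉ maximalIdeal S ^ 2 := by
          intro S hS hxS _; subst hS; exact ⟨hxm, hx2⟩
        obtain ⟨hm, hm2⟩ := key (R j') hRj' (hRj' ▸ hx1)
        exact ⟨hRloc j', hRj' ▸ hx1, hm, hm2, 1, odd_one, hclord⟩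
      have hdj' : dd j' = c := hconst j' (le_trans hi (le_trans hij (le_of_lt hv.1))) hv.2.2.1
      rw [hdd_odd j' ⟨xx j, hoddx⟩] at hdj'
      have := hν3 j' (le_trans hiHj (le_of_lt hv.1))
      omega
    -- all later exceptional parameters are equivalued with `xx i` (escape law on consecutive visit triples)
    have hV : ∀ J, i ≤ J → IsPointStep R P J → O.valuation (xx J) = O.valuation (xx i) := by
      refine all_pointSteps_of_visitPairs R P hrec (fun J => O.valuation (xx J) = O.valuation (xx i)) (i₀ := i) ?_ le_rfl hpti rfl
      intro j j' hij hv hvj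
      obtain ⟨j'', hv'⟩ := VisitSequence.exists_isVisitPair_of_pointStep R P hrec hv.2.2.1
      have hN₁j : N₁ ≤ j := le_trans hN₁i₁ (le_trans hi hij)
      have hiHj : iH ≤ j := le_trans hiHi₁ (le_trans hi hij)
      have hj' : N₁ ≤ j' := le_trans hN₁j (le_of_lt hv.1)
      have hj'' : N₁ ≤ j'' := le_trans hj' (le_of_lt hv'.1)
      have hνj : ν j = c + 1 := hQ j hij hv.2.1
      have hνj' : ν j' = c + 1 := hQ j' (le_trans hij (le_of_lt hv.1)) hv.2.2.1
      have hco : Odd (c + 1) := Nat.odd_iff.mpr (by omega)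
      have heq := hESC K O R P t s hrun hdom0 hreg hdim hperf j j' j'' (xx j) (xx j') hv hv' (hxx j) (hxx j')
        (hΓ j j' (xx j) hN₁j hv (hxx j)) (hΓ j' j'' (xx j') hj' hv' (hxx j'))
        (fun l hl hs' Q _ hQ0 => by
          simp only [Set.mem_insert_iff, Set.mem_singleton_iff] at hl
          rcases hl with rfl | rfl
          · exact h0 _ hj' hv.2.2.1 hs' Q hQ0
          · exact h0 _ hj'' hv'.2.2.1 hs' Q hQ0)
        (fun l hl hs' Q _ hQ1 => by
          simp only [Set.mem_insert_iff, Set.mem_singleton_iff] at hl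
          rcases hl with rfl | rfl
          · exact h1 _ hj' hv.2.2.1 hs' Q hQ1
          · exact h1 _ hj'' hv'.2.2.1 hs' Q hQ1)
        (c + 1) (c + 1) hco hco (by have := hν3 i hiH_i; omega) (by have := hν3 i hiH_i; omega) (hνj ▸ hν j) (hνj' ▸ hν j')
      rw [← heq, hvj]
    -- persistence: `xx i` divides every later element of value `< 1` after the next point step — `hnp` forbids it
    apply hnp
    have hxiR : xx i ∈ R i := (hxx i).1.fst
    have hxiO : xx i ∈ O := (hdom i).1 hxiR
    have hxiv : O.valuation (xx i) < 1 := by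
      obtain ⟨hx, hxP⟩ := (hxx i).1
      obtain ⟨_, hPi⟩ := hpti
      have hm : (⟨xx i, hx⟩ : R i) ∈ maximalIdeal (R i) := by rw [← hPi]; exact hxP
      exact (hval i ⟨xx i, hx⟩).mp hm
    refine ⟨i, xx i, (hxx i).2.1, hxiO, hxiv, fun l hl y hy hvy => ?_⟩
    obtain ⟨J, hJ, hptJ⟩ := hrec l
    obtain ⟨_, hPJ⟩ := hptJ
    have hiJ : i ≤ J := le_trans hl hJ
    have hyJ : y ∈ R J := hmono l J hJ hy
    have hxJ : xx i ∈ R J := hmono i J hiJ hxiR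
    have hymJ : (⟨y, hyJ⟩ : R J) ∈ maximalIdeal (R J) := (hval J ⟨y, hyJ⟩).mpr hvy
    -- `xx i` is an exceptional parameter at `J` (same value as `xx J`)
    have hxJexc : (∃ h : xx i ∈ R J, (⟨xx i, h⟩ : R J) ∈ P J) ∧ xx i ≠ 0 ∧
        ∀ y : R J, y ∈ P J → O.valuation (y : K) ≤ O.valuation (xx i) := by
      refine ⟨⟨hxJ, ?_⟩, (hxx i).2.1, fun z hz => ?_⟩
      · rw [hPJ]; exact (hval J ⟨xx i, hxJ⟩).mpr hxiv
      · rw [← hV J hiJ ⟨_, hPJ⟩]; exact (hxx J).2.2 z hz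
    have hle : R J ≤ R (J + 1) := (hbl J).isLocalBlowup.le
    have hx1 : xx i ∈ R (J + 1) := hle hxJ
    have hspan := VisitLawPointStep.span_image_maximalIdeal_eq hrun hPJ hxJexc hle hx1
    have hyspan : (⟨y, hle hyJ⟩ : R (J + 1)) ∈ Ideal.span {(⟨xx i, hx1⟩ : R (J + 1))} := by
      rw [← hspan]
      exact Ideal.subset_span ⟨⟨y, hyJ⟩, hymJ, rfl⟩
    obtain ⟨r, hr⟩ := Ideal.mem_span_singleton'.mp hyspan
    refine ⟨J + 1, by omega, ?_⟩
    have hrK : y = (r : K) * xx i := by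
      have := congrArg (fun z : R (J + 1) => (z : K)) hr
      simpa using this.symm
    rw [hrK, mul_div_cancel_right₀ _ (hxx i).2.1]
    exact r.2
  -- ### conclusion
  have hc3 : 3 ≤ c := by
    have h := hν3 i₁ hiHi₁
    rcases Nat.even_or_odd c with hce | _
    · exact absurd hcodd (Nat.not_odd_iff_even.mpr hce)
    · by_cases hex : ∃ y : K, IsOddDivisorAt R s 2 i₁ y
      · have := hdd_odd i₁ hex; rw [hc₁] at this
        -- `c = ν − 1 ≥ 2`, and `c` odd
        have h2 : 2 ≤ c := by omega
        rcases hcodd with ⟨m, hm⟩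
        omega
      · have := hdd_no i₁ hex; rw [hc₁] at this; omega
  refine ⟨c, i₁, hcodd, hc3, fun i hi hpt => ?_, fun i₀ => ?_⟩
  · have h := hred i (le_trans hiHi₁ hi)
    rw [hconst i hi hpt] at h
    exact h
  · obtain ⟨i, hi, hOi⟩ := hodd (max i₀ i₁)
    have hi₀ : i₀ ≤ i := le_trans (le_max_left _ _) hi
    have hi₁ : i₁ ≤ i := le_trans (le_max_right _ _) hi
    obtain ⟨hpti, _, hsi, d₀, hd₀odd, hd₀ex, hd₀exact⟩ := hOi
    have hνi : ν i = d₀ := cleanedOrder_unique (hν i) ⟨hRloc i, hsi, hd₀ex, hd₀exact⟩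
    have hdi : dd i = c := hconst i hi₁ hpti
    have hno : ¬ ∃ y : K, IsOddDivisorAt R s 2 i y := by
      intro hex
      rw [hdd_odd i hex] at hdi
      -- `ν i = c + 1` would be even, but `ν i = d₀` is odd
      have h3 := hν3 i (le_trans hiHi₁ hi₁)
      have hνe : ν i = c + 1 := by omega
      rw [hνi] at hνe
      rw [hνe] at hd₀odd
      rcases hcodd with ⟨m, hm⟩
      rcases hd₀odd with ⟨m', hm'⟩
      omega
    refine ⟨i, hi₀, hpti, fun y hy => hno ⟨y, hy⟩, hcodd, ?_⟩
    rw [hdd_no i hno] at hdi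
    rw [← hdi]
    exact hν i

end Summit.ResolutionOfSingularities.ResolutionOfSingularities.Theorems.SwitchingDichotomy.ReducedOrderAssembly
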